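import Summits.QuantumFields.BalabanUV.T4Continuum.Support.NE3LineAverage
import HarnessLib

/-!
# T⁴ programme, node NE3 — census R32 (exact half, step 2a, file 2): SMOOTHING BY LINE AVERAGES — the composition of the `d`
# one-dimensional `M`-averages is an `ℓ²`-contraction that commutes with differences, whose SECOND differences cost only `(4∕M²)·‖∂u‖²`,
# and which moves a periodic field by at most `2^{(d+1)/2}·M·‖∂u‖` in `ℓ²`

Cell `pub-balaban-gaps` (track G2, seat `ne3`; writer prover-pub-balaban-gaps-ne3-g6-0, 2026-08-23), census `run/shared/lean/pub/pub-balaban-gaps/ne/NE3.md`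
§4 R32.  Over file 1 `NE3LineAverage` (one axis) BY NAME.  THIS FILE: the iterated average `avgList M l u` over a list `l` of axes
(`avgList M (i :: l) u = lineAvg M i (avgList M l u)`) and the box average `boxAvg M := avgList M (List.finRange d)`:
(i) periodicity, translation, linearity, commutation with `dPot` (`avgList_add_period`, `avgList_shift`, `avgList_sub`, `dPot_avgList`);
(ii) the `ℓ²(periodBox P)`-CONTRACTION for `P`-periodic data (`sum_normSq_avgList_le`, `sum_normSq_dPot_avgList_le`);
(iii) **`sum_normSq_sdiff_avgList_le`**: for `i ∈ l`, `Σ_x ‖∂_i⁺(avgList l u)(x) − ∂_i⁺(avgList l u)(x − e_i)‖² ≤ (4∕M²)·Σ_x ‖dPot u x i‖²` — the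
line average along `i` telescopes the second difference into two COARSE first differences over `M` (file 1's `dPot_lineAvg_self`), the other
axes commute and contract; (iv) **`sum_normSq_sub_avgList_le`**: `Σ_x ‖u x − avgList l u x‖² ≤ (2^{|l|+1} − 2)·M²·Σ_x Σ_α ‖dPot u x α‖²`;
(v) for the box average: **`sum_normSq_dPot_boxAvg_le`** (Dirichlet energy does not increase), **`sum_normSq_lap_boxAvg_le`**
(`Σ_x ‖Σ_μ (dPot (boxAvg u) x μ − dPot (boxAvg u) (x − e_μ) μ)‖² ≤ (4d∕M²)·Σ_xΣ_α ‖dPot u x α‖²` — the flat Laplacian of the smoothed field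
costs FIRST differences over `M²`), **`sum_normSq_sub_boxAvg_le`** (`≤ 2^{d+1}·M²·Σ‖dPot u‖²`).  The sequel `NE3SmoothBlockMeanInterpolant`
restores exact block means with the squared-tent bump (`NE3SquaredTentBump`) and feeds `bmeInterp`.

CONTENT ([folklore] lattice calculus; 0 sorry; DATA defs `avgList` (structural recursion on the list), `boxAvg`), `M ≥ 1`, `P ≥ 1`.

HONEST FRAMING.  Pure lattice calculus on the periodic lattice; nothing about Bałaban's minimisers; (P♮) on `slicB8`, T-E_w and **NE3 are NOT
proved** here; spine PROVED 0∕9; finite T⁴ rung (B)+1 — NOT continuum YM on ℝ⁴, NOT infinite volume, NOT mass gap, NOT Clay.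
PLACEMENT: `Summits/QuantumFields/BalabanUV/T4Continuum/Support/`.
-/

set_option autoImplicit false

open scoped BigOperators
open Finset

namespace Summit.QuantumFields.BalabanUV.T4Continuum.NE3LineAverageSmoothing

open Literature.MathematicalPhysics.QuantumFieldTheory.Balaban1983to89
open B7Prop1Explicit
open T4AveragingDeficitWallBoundary (periodBox mem_periodBox card_periodBox sum_periodBox_shift)
open NE3TangentNoGoWords (dPot)
open NE3BlockMeanExactInterpolant (normSq_sum_le_card_mul)
open NE3LineAverage (lineAvg lineAvg_shift lineAvg_sub lineAvg_add_period dPot_lineAvg dPot_lineAvg_self sum_normSq_lineAvg_le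
  dPot_add_period sum_normSq_sub_lineAvg_le)

noncomputable section

variable {d : ℕ}
variable {𝔸 : Type*} [NormedRing 𝔸] [NormedSpace ℝ 𝔸]

/-! ## §2 Iterated line averages over a list of axes -/

/-- THE ITERATED LINE AVERAGE over a list of axes (outermost first): `avgList M [] u = u`, `avgList M (i :: l) u = lineAvg M i (avgList M l u)`.
[folklore] -/
def avgList (M : ℕ) : List (Fin d) → (Site d → 𝔸) → Site d → 𝔸
  | [], u => u
  | i :: l, u => lineAvg M i (avgList M l u)

/-- `avgList M [] u = u`. [folklore] -/
@[simp] theorem avgList_nil (M : ℕ) (u : Site d → 𝔸) : avgList M [] u = u := rfl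

/-- `avgList M (i :: l) u = lineAvg M i (avgList M l u)`. [folklore] -/
@[simp] theorem avgList_cons (M : ℕ) (i : Fin d) (l : List (Fin d)) (u : Site d → 𝔸) :
    avgList M (i :: l) u = lineAvg M i (avgList M l u) := rfl

/-- Periodicity is preserved by the iterated average. [folklore] -/
theorem avgList_add_period (M : ℕ) {P : ℕ} : ∀ (l : List (Fin d)) {u : Site d → 𝔸},
    (∀ (x : Site d) (τ : Fin d), u (x + (P : ℤ) • e τ) = u x) →
      ∀ (x : Site d) (τ : Fin d), avgList M l u (x + (P : ℤ) • e τ) = avgList M l u x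
  | [], _, hu => hu
  | i :: l, _, hu => fun x τ => by
      rw [avgList_cons]
      exact lineAvg_add_period M i (avgList_add_period M l hu) x τ

/-- The iterated average commutes with translations. [folklore] -/
theorem avgList_shift (M : ℕ) (v : Site d) : ∀ (l : List (Fin d)) (u : Site d → 𝔸),
    avgList M l (fun y => u (y + v)) = fun x => avgList M l u (x + v)
  | [], _ => rfl
  | i :: l, u => by
      funext x
      rw [avgList_cons, avgList_cons, avgList_shift M v l u, lineAvg_shift]

/-- The iterated average of a difference. [folklore] -/
theorem avgList_sub (M : ℕ) : ∀ (l : List (Fin d)) (u w : Site d → 𝔸),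
    avgList M l (fun y => u y - w y) = fun x => avgList M l u x - avgList M l w x
  | [], _, _ => rfl
  | i :: l, u, w => by
      funext x
      rw [avgList_cons, avgList_cons, avgList_cons, avgList_sub M l u w, lineAvg_sub]

/-- **THE ITERATED AVERAGE COMMUTES WITH THE COBOUNDARY**: `dPot (avgList M l u) x α = avgList M l (dPot u · α) x`. [folklore] -/
theorem dPot_avgList (M : ℕ) (α : Fin d) : ∀ (l : List (Fin d)) (u : Site d → 𝔸),
    (fun x => dPot (avgList M l u) x α) = avgList M l (fun y => dPot u y α)
  | [], _ => rfl
  | i :: l, u => by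
      funext x
      rw [avgList_cons, avgList_cons, dPot_lineAvg, ← dPot_avgList M α l u]

/-- **THE ITERATED AVERAGE IS AN `ℓ²`-CONTRACTION ON PERIODIC DATA** (`M, P ≥ 1`). [folklore] -/
theorem sum_normSq_avgList_le {M : ℕ} (hM : 1 ≤ M) {P : ℕ} (hP : 1 ≤ P) : ∀ (l : List (Fin d)) {g : Site d → 𝔸},
    (∀ (x : Site d) (τ : Fin d), g (x + (P : ℤ) • e τ) = g x) →
      ∑ x ∈ periodBox (d := d) P, ‖avgList M l g x‖ ^ 2 ≤ ∑ x ∈ periodBox (d := d) P, ‖g x‖ ^ 2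
  | [], _, _ => le_rfl
  | i :: l, _, hg => by
      simp only [avgList_cons]
      exact (sum_normSq_lineAvg_le hM hP i (avgList_add_period M l hg)).trans (sum_normSq_avgList_le hM hP l hg)

/-- The Dirichlet energy along one axis does not increase under the iterated average. [folklore] -/
theorem sum_normSq_dPot_avgList_le_dir {M : ℕ} (hM : 1 ≤ M) {P : ℕ} (hP : 1 ≤ P) (l : List (Fin d)) {u : Site d → 𝔸}
    (hu : ∀ (x : Site d) (τ : Fin d), u (x + (P : ℤ) • e τ) = u x) (α : Fin d) :
    ∑ x ∈ periodBox (d := d) P, ‖dPot (avgList M l u) x α‖ ^ 2 ≤ ∑ x ∈ periodBox (d := d) P, ‖dPot u x α‖ ^ 2 := by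
  have h := sum_normSq_avgList_le hM hP l (g := fun y => dPot u y α) (dPot_add_period hu α)
  have hfun := dPot_avgList M α l u
  calc ∑ x ∈ periodBox (d := d) P, ‖dPot (avgList M l u) x α‖ ^ 2
      = ∑ x ∈ periodBox (d := d) P, ‖avgList M l (fun y => dPot u y α) x‖ ^ 2 :=
        Finset.sum_congr rfl fun x _ => by rw [← hfun]
    _ ≤ _ := h

/-- **THE DIRICHLET ENERGY DOES NOT INCREASE UNDER THE ITERATED AVERAGE**. [folklore] -/
theorem sum_normSq_dPot_avgList_le {M : ℕ} (hM : 1 ≤ M) {P : ℕ} (hP : 1 ≤ P) (l : List (Fin d)) {u : Site d → 𝔸}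
    (hu : ∀ (x : Site d) (τ : Fin d), u (x + (P : ℤ) • e τ) = u x) :
    ∑ x ∈ periodBox (d := d) P, ∑ α : Fin d, ‖dPot (avgList M l u) x α‖ ^ 2
      ≤ ∑ x ∈ periodBox (d := d) P, ∑ α : Fin d, ‖dPot u x α‖ ^ 2 := by
  rw [Finset.sum_comm, Finset.sum_comm (s := periodBox (d := d) P)]
  exact Finset.sum_le_sum fun α _ => sum_normSq_dPot_avgList_le_dir hM hP l hu α

/-- **THE SECOND-DIFFERENCE GAIN OF SMOOTHING**: for `i ∈ l` and `P`-periodic `u` (`M, P ≥ 1`),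
`Σ_{x∈periodBox P} ‖dPot (avgList M l u) x i − dPot (avgList M l u) (x − e_i) i‖² ≤ (4∕M²)·Σ_x ‖dPot u x i‖²` — the line average
along `i` telescopes the second difference into a difference of two COARSE first differences, each over `M`. [folklore] -/
theorem sum_normSq_sdiff_avgList_le {M : ℕ} (hM : 1 ≤ M) {P : ℕ} (hP : 1 ≤ P) (i : Fin d) : ∀ (l : List (Fin d)), i ∈ l →
    ∀ {u : Site d → 𝔸}, (∀ (x : Site d) (τ : Fin d), u (x + (P : ℤ) • e τ) = u x) →
      ∑ x ∈ periodBox (d := d) P, ‖dPot (avgList M l u) x i - dPot (avgList M l u) (x - e i) i‖ ^ 2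
        ≤ 4 / (M : ℝ) ^ 2 * ∑ x ∈ periodBox (d := d) P, ‖dPot u x i‖ ^ 2
  | [], hi, _, _ => absurd hi (List.not_mem_nil)
  | j :: l, hi, u, hu => by
      have hM0 : (0 : ℝ) < M := by exact_mod_cast (by omega : 0 < M)
      have hwP := avgList_add_period M l hu
      set w : Site d → 𝔸 := avgList M l u with hw
      have hGw : ∑ x ∈ periodBox (d := d) P, ‖dPot w x i‖ ^ 2 ≤ ∑ x ∈ periodBox (d := d) P, ‖dPot u x i‖ ^ 2 :=
        sum_normSq_dPot_avgList_le_dir hM hP l hu i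
      simp only [avgList_cons]
      by_cases hji : j = i
      · subst hji
        -- the telescoped axis: `sdiff (lineAvg j w) x = M⁻¹ • (dPot w (x − e + M e) j − dPot w (x − e) j)`
        have hid : ∀ x : Site d, dPot (lineAvg M j w) x j - dPot (lineAvg M j w) (x - e j) j
            = ((M : ℝ)⁻¹) • (dPot w (x - e j + ((M : ℕ) : ℤ) • e j) j - dPot w (x - e j) j) := by
          intro x
          rw [dPot_lineAvg_self, dPot_lineAvg_self, ← smul_sub]
          congr 1
          simp only [dPot, sub_add_cancel]
          have h1 : x - e j + ((M : ℕ) : ℤ) • e j + e j = x + ((M : ℕ) : ℤ) • e j := by abel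
          rw [h1]
          abel
        have hshift1 : ∑ x ∈ periodBox (d := d) P, ‖dPot w (x - e j + ((M : ℕ) : ℤ) • e j) j‖ ^ 2
            = ∑ x ∈ periodBox (d := d) P, ‖dPot w x j‖ ^ 2 := by
          have h := sum_periodBox_shift P hP (g := fun x => ‖dPot w x j‖ ^ 2) (fun x κ => by simp only [dPot_add_period hwP])
            (-e j + ((M : ℕ) : ℤ) • e j)
          refine Eq.trans (Finset.sum_congr rfl fun x _ => ?_) h
          rw [sub_eq_add_neg, add_assoc]
        have hshift2 : ∑ x ∈ periodBox (d := d) P, ‖dPot w (x - e j) j‖ ^ 2 = ∑ x ∈ periodBox (d := d) P, ‖dPot w x j‖ ^ 2 := by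
          have h := sum_periodBox_shift P hP (g := fun x => ‖dPot w x j‖ ^ 2) (fun x κ => by simp only [dPot_add_period hwP]) (-e j)
          refine Eq.trans (Finset.sum_congr rfl fun x _ => ?_) h
          rw [sub_eq_add_neg]
        have hpt : ∀ x : Site d, ‖dPot (lineAvg M j w) x j - dPot (lineAvg M j w) (x - e j) j‖ ^ 2
            ≤ 2 / (M : ℝ) ^ 2 * (‖dPot w (x - e j + ((M : ℕ) : ℤ) • e j) j‖ ^ 2 + ‖dPot w (x - e j) j‖ ^ 2) := by
          intro x
          rw [hid x, norm_smul, mul_pow, Real.norm_of_nonneg (inv_nonneg.mpr hM0.le)]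
          have hsub := norm_sub_le (dPot w (x - e j + ((M : ℕ) : ℤ) • e j) j) (dPot w (x - e j) j)
          have ha := norm_nonneg (dPot w (x - e j + ((M : ℕ) : ℤ) • e j) j)
          have hb := norm_nonneg (dPot w (x - e j) j)
          have hsq : ‖dPot w (x - e j + ((M : ℕ) : ℤ) • e j) j - dPot w (x - e j) j‖ ^ 2
              ≤ 2 * (‖dPot w (x - e j + ((M : ℕ) : ℤ) • e j) j‖ ^ 2 + ‖dPot w (x - e j) j‖ ^ 2) := by
            nlinarith [norm_nonneg (dPot w (x - e j + ((M : ℕ) : ℤ) • e j) j - dPot w (x - e j) j),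
              sq_nonneg (‖dPot w (x - e j + ((M : ℕ) : ℤ) • e j) j‖ - ‖dPot w (x - e j) j‖)]
          have hinv : ((M : ℝ)⁻¹) ^ 2 = 1 / (M : ℝ) ^ 2 := by rw [inv_pow, one_div]
          rw [hinv]
          calc 1 / (M : ℝ) ^ 2 * ‖dPot w (x - e j + ((M : ℕ) : ℤ) • e j) j - dPot w (x - e j) j‖ ^ 2
              ≤ 1 / (M : ℝ) ^ 2 * (2 * (‖dPot w (x - e j + ((M : ℕ) : ℤ) • e j) j‖ ^ 2 + ‖dPot w (x - e j) j‖ ^ 2)) :=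
                mul_le_mul_of_nonneg_left hsq (by positivity)
            _ = _ := by ring
        calc ∑ x ∈ periodBox (d := d) P, ‖dPot (lineAvg M j w) x j - dPot (lineAvg M j w) (x - e j) j‖ ^ 2
            ≤ ∑ x ∈ periodBox (d := d) P, 2 / (M : ℝ) ^ 2
                * (‖dPot w (x - e j + ((M : ℕ) : ℤ) • e j) j‖ ^ 2 + ‖dPot w (x - e j) j‖ ^ 2) :=
              Finset.sum_le_sum fun x _ => hpt x
          _ = 2 / (M : ℝ) ^ 2 * (∑ x ∈ periodBox (d := d) P, ‖dPot w x j‖ ^ 2 + ∑ x ∈ periodBox (d := d) P, ‖dPot w x j‖ ^ 2) := by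
              rw [← Finset.mul_sum, Finset.sum_add_distrib, hshift1, hshift2]
          _ = 4 / (M : ℝ) ^ 2 * ∑ x ∈ periodBox (d := d) P, ‖dPot w x j‖ ^ 2 := by ring
          _ ≤ 4 / (M : ℝ) ^ 2 * ∑ x ∈ periodBox (d := d) P, ‖dPot u x j‖ ^ 2 :=
              mul_le_mul_of_nonneg_left hGw (by positivity)
      · -- another axis: the line average commutes with the second difference along `i` and contracts
        have hil : i ∈ l := by
          rcases List.mem_cons.mp hi with h | h
          · exact absurd h.symm hji
          · exact h
        have hcomm : ∀ x : Site d, dPot (lineAvg M j w) x i - dPot (lineAvg M j w) (x - e i) i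
            = lineAvg M j (fun y => dPot w y i - dPot w (y - e i) i) x := by
          intro x
          simp only [lineAvg, dPot, ← smul_sub, ← Finset.sum_sub_distrib]
          congr 1
          refine Finset.sum_congr rfl fun s _ => ?_
          have e1 : x + e i + (s : ℤ) • e j = x + (s : ℤ) • e j + e i := by abel
          have e2 : x - e i + e i + (s : ℤ) • e j = x + (s : ℤ) • e j - e i + e i := by abel
          have e3 : x - e i + (s : ℤ) • e j = x + (s : ℤ) • e j - e i := by abel
          rw [e1, e2, e3]
        have hsP : ∀ (x : Site d) (τ : Fin d), (fun y => dPot w y i - dPot w (y - e i) i) (x + (P : ℤ) • e τ)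
            = (fun y => dPot w y i - dPot w (y - e i) i) x := by
          intro x τ
          simp only
          rw [dPot_add_period hwP, show x + (P : ℤ) • e τ - e i = (x - e i) + (P : ℤ) • e τ by abel, dPot_add_period hwP]
        calc ∑ x ∈ periodBox (d := d) P, ‖dPot (lineAvg M j w) x i - dPot (lineAvg M j w) (x - e i) i‖ ^ 2
            = ∑ x ∈ periodBox (d := d) P, ‖lineAvg M j (fun y => dPot w y i - dPot w (y - e i) i) x‖ ^ 2 :=
              Finset.sum_congr rfl fun x _ => by rw [hcomm x]
          _ ≤ ∑ x ∈ periodBox (d := d) P, ‖dPot w x i - dPot w (x - e i) i‖ ^ 2 := sum_normSq_lineAvg_le hM hP j hsP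
          _ ≤ 4 / (M : ℝ) ^ 2 * ∑ x ∈ periodBox (d := d) P, ‖dPot u x i‖ ^ 2 := sum_normSq_sdiff_avgList_le hM hP i l hil hu

/-- **THE ITERATED AVERAGE MOVES A PERIODIC FIELD BY `O(M)·‖∂u‖`**:
`Σ_x ‖u x − avgList M l u x‖² ≤ (2^{|l|+1} − 2)·M²·Σ_x Σ_α ‖dPot u x α‖²`. [folklore] -/
theorem sum_normSq_sub_avgList_le {M : ℕ} (hM : 1 ≤ M) {P : ℕ} (hP : 1 ≤ P) : ∀ (l : List (Fin d)) {u : Site d → 𝔸},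
    (∀ (x : Site d) (τ : Fin d), u (x + (P : ℤ) • e τ) = u x) →
      ∑ x ∈ periodBox (d := d) P, ‖u x - avgList M l u x‖ ^ 2
        ≤ ((2 : ℝ) ^ (l.length + 1) - 2) * (M : ℝ) ^ 2 * ∑ x ∈ periodBox (d := d) P, ∑ α : Fin d, ‖dPot u x α‖ ^ 2
  | [], u, _ => by simp
  | j :: l, u, hu => by
      set G : ℝ := ∑ x ∈ periodBox (d := d) P, ∑ α : Fin d, ‖dPot u x α‖ ^ 2 with hG
      have hG0 : 0 ≤ G := Finset.sum_nonneg fun _ _ => Finset.sum_nonneg fun _ _ => sq_nonneg _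
      have hwP := avgList_add_period M l hu
      set w : Site d → 𝔸 := avgList M l u with hw
      have ih := sum_normSq_sub_avgList_le hM hP l hu
      -- `u − lineAvg j w = (u − lineAvg j u) + lineAvg j (u − w)`
      have hsplit : ∀ x : Site d, u x - lineAvg M j w x = (u x - lineAvg M j u x) + lineAvg M j (fun y => u y - w y) x := by
        intro x; rw [lineAvg_sub]; abel
      have hpt : ∀ x : Site d, ‖u x - lineAvg M j w x‖ ^ 2
          ≤ 2 * ‖u x - lineAvg M j u x‖ ^ 2 + 2 * ‖lineAvg M j (fun y => u y - w y) x‖ ^ 2 := by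
        intro x
        rw [hsplit x]
        have h := norm_add_le (u x - lineAvg M j u x) (lineAvg M j (fun y => u y - w y) x)
        nlinarith [norm_nonneg (u x - lineAvg M j u x + lineAvg M j (fun y => u y - w y) x), norm_nonneg (u x - lineAvg M j u x),
          norm_nonneg (lineAvg M j (fun y => u y - w y) x), sq_nonneg (‖u x - lineAvg M j u x‖ - ‖lineAvg M j (fun y => u y - w y) x‖)]
      have hdP : ∀ (x : Site d) (τ : Fin d), (fun y => u y - w y) (x + (P : ℤ) • e τ) = (fun y => u y - w y) x := by
        intro x τ; simp only [hu, hwP]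
      have h1 : ∑ x ∈ periodBox (d := d) P, ‖u x - lineAvg M j u x‖ ^ 2 ≤ (M : ℝ) ^ 2 * G := by
        refine (sum_normSq_sub_lineAvg_le hM hP j hu).trans (mul_le_mul_of_nonneg_left ?_ (by positivity))
        exact Finset.sum_le_sum fun x _ => Finset.single_le_sum (fun α _ => sq_nonneg (‖dPot u x α‖)) (Finset.mem_univ j)
      have h2 : ∑ x ∈ periodBox (d := d) P, ‖lineAvg M j (fun y => u y - w y) x‖ ^ 2
          ≤ ((2 : ℝ) ^ (l.length + 1) - 2) * (M : ℝ) ^ 2 * G :=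
        (sum_normSq_lineAvg_le hM hP j hdP).trans ih
      calc ∑ x ∈ periodBox (d := d) P, ‖u x - lineAvg M j w x‖ ^ 2
          ≤ ∑ x ∈ periodBox (d := d) P, (2 * ‖u x - lineAvg M j u x‖ ^ 2 + 2 * ‖lineAvg M j (fun y => u y - w y) x‖ ^ 2) :=
            Finset.sum_le_sum fun x _ => hpt x
        _ = 2 * ∑ x ∈ periodBox (d := d) P, ‖u x - lineAvg M j u x‖ ^ 2
              + 2 * ∑ x ∈ periodBox (d := d) P, ‖lineAvg M j (fun y => u y - w y) x‖ ^ 2 := by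
            rw [Finset.sum_add_distrib, ← Finset.mul_sum, ← Finset.mul_sum]
        _ ≤ 2 * ((M : ℝ) ^ 2 * G) + 2 * (((2 : ℝ) ^ (l.length + 1) - 2) * (M : ℝ) ^ 2 * G) := by gcongr
        _ = ((2 : ℝ) ^ ((j :: l).length + 1) - 2) * (M : ℝ) ^ 2 * G := by
            rw [List.length_cons, pow_succ, pow_succ]; ring

/-! ## §3 The box average: all axes -/

/-- THE BOX AVERAGE: the line averages over all `d` axes composed, `boxAvg M u = avgList M (List.finRange d) u`
(`= M^{−d} Σ_{v∈[0,M)^d} u (· + v)`). [folklore] -/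
def boxAvg (M : ℕ) (u : Site d → 𝔸) : Site d → 𝔸 := avgList M (List.finRange d) u

/-- Periodicity of the box average. [folklore] -/
theorem boxAvg_add_period (M : ℕ) {P : ℕ} {u : Site d → 𝔸} (hu : ∀ (x : Site d) (τ : Fin d), u (x + (P : ℤ) • e τ) = u x)
    (x : Site d) (τ : Fin d) : boxAvg M u (x + (P : ℤ) • e τ) = boxAvg M u x :=
  avgList_add_period M (List.finRange d) hu x τ

/-- **(S1) THE DIRICHLET ENERGY OF THE BOX AVERAGE**: `Σ_x Σ_α ‖dPot (boxAvg M u) x α‖² ≤ Σ_x Σ_α ‖dPot u x α‖²`. [folklore] -/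
theorem sum_normSq_dPot_boxAvg_le {M : ℕ} (hM : 1 ≤ M) {P : ℕ} (hP : 1 ≤ P) {u : Site d → 𝔸}
    (hu : ∀ (x : Site d) (τ : Fin d), u (x + (P : ℤ) • e τ) = u x) :
    ∑ x ∈ periodBox (d := d) P, ∑ α : Fin d, ‖dPot (boxAvg M u) x α‖ ^ 2
      ≤ ∑ x ∈ periodBox (d := d) P, ∑ α : Fin d, ‖dPot u x α‖ ^ 2 :=
  sum_normSq_dPot_avgList_le hM hP (List.finRange d) hu

/-- **(S2) THE LAPLACIAN OF THE BOX AVERAGE COSTS FIRST DIFFERENCES OVER `M²`**: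
`Σ_x ‖Σ_μ (dPot (boxAvg M u) x μ − dPot (boxAvg M u) (x − e_μ) μ)‖² ≤ (4d∕M²)·Σ_x Σ_α ‖dPot u x α‖²`. [folklore] -/
theorem sum_normSq_lap_boxAvg_le {M : ℕ} (hM : 1 ≤ M) {P : ℕ} (hP : 1 ≤ P) {u : Site d → 𝔸}
    (hu : ∀ (x : Site d) (τ : Fin d), u (x + (P : ℤ) • e τ) = u x) :
    ∑ x ∈ periodBox (d := d) P, ‖∑ μ : Fin d, (dPot (boxAvg M u) x μ - dPot (boxAvg M u) (x - e μ) μ)‖ ^ 2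
      ≤ 4 * d / (M : ℝ) ^ 2 * ∑ x ∈ periodBox (d := d) P, ∑ α : Fin d, ‖dPot u x α‖ ^ 2 := by
  have hM0 : (0 : ℝ) < M := by exact_mod_cast (by omega : 0 < M)
  unfold boxAvg
  calc ∑ x ∈ periodBox (d := d) P, ‖∑ μ : Fin d, (dPot (avgList M (List.finRange d) u) x μ
        - dPot (avgList M (List.finRange d) u) (x - e μ) μ)‖ ^ 2
      ≤ ∑ x ∈ periodBox (d := d) P, ((d : ℝ) * ∑ μ : Fin d, ‖dPot (avgList M (List.finRange d) u) x μ
          - dPot (avgList M (List.finRange d) u) (x - e μ) μ‖ ^ 2) :=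
        Finset.sum_le_sum fun x _ => by
          have h := normSq_sum_le_card_mul (Finset.univ : Finset (Fin d))
            (fun μ => dPot (avgList M (List.finRange d) u) x μ - dPot (avgList M (List.finRange d) u) (x - e μ) μ)
          rwa [Finset.card_univ, Fintype.card_fin] at h
    _ = (d : ℝ) * ∑ μ : Fin d, ∑ x ∈ periodBox (d := d) P, ‖dPot (avgList M (List.finRange d) u) x μ
          - dPot (avgList M (List.finRange d) u) (x - e μ) μ‖ ^ 2 := by
        rw [← Finset.mul_sum, Finset.sum_comm]
    _ ≤ (d : ℝ) * ∑ μ : Fin d, (4 / (M : ℝ) ^ 2 * ∑ x ∈ periodBox (d := d) P, ‖dPot u x μ‖ ^ 2) :=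
        mul_le_mul_of_nonneg_left (Finset.sum_le_sum fun μ _ =>
          sum_normSq_sdiff_avgList_le hM hP μ (List.finRange d) (List.mem_finRange μ) hu) (Nat.cast_nonneg _)
    _ = 4 * d / (M : ℝ) ^ 2 * ∑ x ∈ periodBox (d := d) P, ∑ α : Fin d, ‖dPot u x α‖ ^ 2 := by
        rw [← Finset.mul_sum, Finset.sum_comm]; ring

/-- **(S3) THE BOX AVERAGE MOVES A PERIODIC FIELD BY `O(M)·‖∂u‖`**: `Σ_x ‖u x − boxAvg M u x‖² ≤ 2^{d+1}·M²·Σ_x Σ_α ‖dPot u x α‖²`. [folklore] -/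
theorem sum_normSq_sub_boxAvg_le {M : ℕ} (hM : 1 ≤ M) {P : ℕ} (hP : 1 ≤ P) {u : Site d → 𝔸}
    (hu : ∀ (x : Site d) (τ : Fin d), u (x + (P : ℤ) • e τ) = u x) :
    ∑ x ∈ periodBox (d := d) P, ‖u x - boxAvg M u x‖ ^ 2
      ≤ (2 : ℝ) ^ (d + 1) * (M : ℝ) ^ 2 * ∑ x ∈ periodBox (d := d) P, ∑ α : Fin d, ‖dPot u x α‖ ^ 2 := by
  have h := sum_normSq_sub_avgList_le hM hP (List.finRange d) hu
  rw [List.length_finRange] at h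
  refine h.trans (mul_le_mul_of_nonneg_right (mul_le_mul_of_nonneg_right (by linarith) (by positivity))
    (Finset.sum_nonneg fun _ _ => Finset.sum_nonneg fun _ _ => sq_nonneg _))

end

end Summit.QuantumFields.BalabanUV.T4Continuum.NE3LineAverageSmoothing
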